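import Mathlib
import Literature.Computability.AlgebraicComplexity.BurgisserBooleanPartsA3Assembly
import HarnessLib

/-!
# Route GaugeDescent — `DescentGlue` (stmt-ValiantsHypothesis-6637), part F: a good prime in a
# dyadic window

If `M ≥ 1` has at most `2^b` prime factors then some prime `p` with `2^ℓ < p ≤ 2^{2(ℓ+b+4)}` does
not divide `M` (`exists_good_prime`): by Chebyshev's bound (the tree's `primeCounting_two_pow_ge`,
from Mathlib's `Chebyshev.pi_ge`) `π(2^r) ≥ 2^{r-1}/r > 2^ℓ + 2^b ≥ π(2^ℓ) + ω(M)` for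
`r = 2(ℓ+b+4)`. This is the prime-supply step of the glue ("Chebyshev supplies such `p` in
`(2^ℓ(n), 2^r(n)]`"). Honest framing: arithmetic bookkeeping; `VP ≠ VNP` is NOT proved.
-/

set_option linter.dupNamespace false

namespace Summit.ValiantsHypothesis.ValiantsHypothesis.Theorems.GaugeDescent

open Finset Nat Literature.Computability.AlgebraicComplexity

namespace DescentGlue

/-- The window arithmetic: `2(ℓ+b+4) · (2^ℓ + 2^b) < 2^{2(ℓ+b+4) - 1}`. [folklore] -/
theorem window_arith (ℓ b : ℕ) :
    2 * (ℓ + b + 4) * (2 ^ ℓ + 2 ^ b) < 2 ^ (2 * (ℓ + b + 4) - 1) := by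
  set s := ℓ + b + 4 with hs
  have h1 : 2 ^ ℓ + 2 ^ b ≤ 2 ^ (s - 3) := by
    have hℓ : 2 ^ ℓ ≤ 2 ^ (ℓ + b) := Nat.pow_le_pow_right two_pos (by omega)
    have hb : 2 ^ b ≤ 2 ^ (ℓ + b) := Nat.pow_le_pow_right two_pos (by omega)
    have : 2 ^ (s - 3) = 2 ^ (ℓ + b) * 2 := by
      rw [show s - 3 = ℓ + b + 1 by omega, pow_succ]
    omega
  have h2 : s < 2 ^ (s + 1) := (Nat.lt_two_pow_self).trans (Nat.pow_lt_pow_right one_lt_two (by omega))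
  calc 2 * s * (2 ^ ℓ + 2 ^ b) ≤ 2 * s * 2 ^ (s - 3) := Nat.mul_le_mul_left _ h1
    _ < 2 * 2 ^ (s + 1) * 2 ^ (s - 3) :=
        Nat.mul_lt_mul_of_lt_of_le (Nat.mul_lt_mul_of_pos_left h2 two_pos) le_rfl (by positivity)
    _ = 2 ^ (2 * s - 1) := by
        rw [← pow_succ', ← pow_add]
        congr 1
        omega

/-- **A good prime in a dyadic window.** If `M ≥ 1` has at most `2^b` distinct prime factors,
then some prime `p` with `2^ℓ < p ≤ 2^{2(ℓ+b+4)}` does not divide `M`.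
[cite: Burgisser2000TCS, §5 (A3) p. 85 (prime selection)] -/
theorem exists_good_prime (ℓ b M : ℕ) (hM : 0 < M) (hbad : M.primeFactors.card ≤ 2 ^ b) :
    ∃ p : ℕ, p.Prime ∧ 2 ^ ℓ < p ∧ p ≤ 2 ^ (2 * (ℓ + b + 4)) ∧ ¬ p ∣ M := by
  by_contra hcon
  push Not at hcon
  set r := 2 * (ℓ + b + 4) with hr
  -- every prime `≤ 2^r` is `≤ 2^ℓ` or divides `M`
  have hsub : primesLE (2 ^ r) ⊆ primesLE (2 ^ ℓ) ∪ M.primeFactors := by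
    intro p hp
    rw [mem_primesLE] at hp
    rw [mem_union, mem_primesLE, Nat.mem_primeFactors]
    by_cases hpl : p ≤ 2 ^ ℓ
    · exact Or.inl ⟨hpl, hp.2⟩
    · exact Or.inr ⟨hp.2, hcon p hp.2 (not_le.mp hpl) hp.1, hM.ne'⟩
  have hcard : Nat.primeCounting (2 ^ r) ≤ 2 ^ ℓ + 2 ^ b := by
    rw [← primesLE_card_eq_primeCounting]
    calc #(primesLE (2 ^ r)) ≤ #(primesLE (2 ^ ℓ) ∪ M.primeFactors) := card_le_card hsub
      _ ≤ #(primesLE (2 ^ ℓ)) + #M.primeFactors := card_union_le _ _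
      _ ≤ 2 ^ ℓ + 2 ^ b := by
          refine Nat.add_le_add ?_ hbad
          rw [primesLE_eq_filter_Icc_two]
          calc #(filter Nat.Prime (Icc 2 (2 ^ ℓ))) ≤ #(Icc 2 (2 ^ ℓ)) := card_filter_le _ _
            _ = 2 ^ ℓ + 1 - 2 := Nat.card_Icc 2 _
            _ ≤ 2 ^ ℓ := Nat.sub_le_of_le_add (by omega)
  -- Chebyshev: `2^{r-1}/r ≤ π(2^r)`
  have hr3 : 3 ≤ r := by omega
  have hcheb := primeCounting_two_pow_ge hr3
  have hrpos : (0 : ℝ) < r := by exact_mod_cast (show 0 < r by omega)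
  rw [div_le_iff₀ hrpos] at hcheb
  have hnat : 2 ^ (r - 1) ≤ Nat.primeCounting (2 ^ r) * r := by exact_mod_cast hcheb
  have hw := window_arith ℓ b
  rw [← hr] at hw
  have : 2 ^ (r - 1) ≤ (2 ^ ℓ + 2 ^ b) * r := hnat.trans (Nat.mul_le_mul_right _ hcard)
  have : 2 ^ (r - 1) < 2 ^ (r - 1) := by
    calc 2 ^ (r - 1) ≤ (2 ^ ℓ + 2 ^ b) * r := this
      _ = r * (2 ^ ℓ + 2 ^ b) := by ring
      _ < 2 ^ (r - 1) := hw
  exact lt_irrefl _ this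

end DescentGlue

end Summit.ValiantsHypothesis.ValiantsHypothesis.Theorems.GaugeDescent
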